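import Summits.CriticalPhenomena.CardyFormulaZ2.Theses.ModulusResponse
import HarnessLib

/-! Strategist sketch (census signatures only; nothing here is filed as an item). -/

namespace Summit.CriticalPhenomena.CardyFormulaZ2.Cruxes.SmirnovResponse.Strategist

open scoped Topology

/-- S⁺ (strengthen, "IntraCellBound"): per-cell O(δ²) bound on the Russo defect at Smirnov's point for cells at
macroscopic distance `≥ η` from the boundary — no inter-cell cancellation allowed. -/
def IntraCellBound : Prop :=
  ∀ (μ : ℝ → MeasureTheory.Measure (Literature.Probability.Percolation.BondConfig (Literature.Probability.LatticeModels.Site 2))) (S : ℝ → ℂ → ℂ), (∀ u, μ u = MeasureTheory.Measure.map (fun p : Set (Literature.Probability.LatticeModels.Site 2) × Set (Literature.Probability.LatticeModels.Site 2) ↦ {e | ∃ m, (m ∈ p.1 ∧ e = s(m - Pi.single 0 1, m)) ∨ ((m ∈ p.1 ↔ m ∉ p.2) ∧ e = s(m - Pi.single 1 1, m))}) ((ProbabilityTheory.setBernoulli Set.univ Literature.Probability.Percolation.half).prod (ProbabilityTheory.setBernoulli Set.univ (Set.projIcc 0 1 zero_le_one u)))) → (∀ t z, S t z = (Real.cosh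 t : ℂ) * z + Complex.I * (Real.sinh t : ℂ) * (starRingEnd ℂ) z) → ∀ (R : Literature.Probability.RandomPlanarGeometry.ConformalRectangle) (η : ℝ), 0 < η → ∃ C : ℝ, ∀ᶠ δ in nhdsWithin (0 : ℝ) (Set.Ioi 0), ∀ m : Literature.Probability.LatticeModels.Site 2, η ≤ Metric.infDist (((δ : ℝ) : ℂ) * Literature.Probability.LatticeModels.Site.toComplex m) (S (-(Real.log 3) / 4) '' R.carrier)ᶜ → |(μ 0).real ((fun ω ↦ symmDiff ω {s(m - Pi.single 1 1, m)}) ⁻¹' Literature.Probability.Percolation.discreteCrossing (S (-(Real.log 3) / 4) '' R.carrier) δ (S (-(Real.log 3) / 4) '' R.arc 0) (S (-(Real.log 3) / 4) '' R.arc 2)) - (μ 0).real (Literature.Probability.Percolation.discreteCrossing (S (-(Real.log 3) / 4) '' R.carrier) δ (S (-(Real.log 3) / 4) '' R.arc 0) (S (-(Real.log 3) / 4) '' R.arc 2))| ≤ C * δ ^ 2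

/-- S-bdry ("BoundaryLayerTight"): for some collar width `η > 0` the defect sum over the cells within `η` of the boundary stays
bounded. -/
def BoundaryLayerTight : Prop :=
  ∀ (μ : ℝ → MeasureTheory.Measure (Literature.Probability.Percolation.BondConfig (Literature.Probability.LatticeModels.Site 2))) (S : ℝ → ℂ → ℂ), (∀ u, μ u = MeasureTheory.Measure.map (fun p : Set (Literature.Probability.LatticeModels.Site 2) × Set (Literature.Probability.LatticeModels.Site 2) ↦ {e | ∃ m, (m ∈ p.1 ∧ e = s(m - Pi.single 0 1, m)) ∨ ((m ∈ p.1 ↔ m ∉ p.2) ∧ e = s(m - Pi.single 1 1, m))}) ((ProbabilityTheory.setBernoulli Set.univ Literature.Probability.Percolation.half).prod (ProbabilityTheory.setBernoulli Set.univ (Set.projIcc 0 1 zero_le_one u)))) → (∀ t z, S t z = (Real.cosh t : ℂ) * z + Complex.I * (Real.sinh t : ℂ) * (starRingEnd ℂ) z) → ∀ (R : Literature.Probability.RandomPlanarGeometry.ConformalRectangle), ∃ η : ℝ, 0 < η ∧ ∃ C : ℝ, ∀ᶠ δ in nhdsWithin (0 : ℝ) (Set.Ioi 0), |finsum (fun m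 : Literature.Probability.LatticeModels.Site 2 ↦ if Metric.infDist (((δ : ℝ) : ℂ) * Literature.Probability.LatticeModels.Site.toComplex m) (S (-(Real.log 3) / 4) '' R.carrier)ᶜ < η then (μ 0).real ((fun ω ↦ symmDiff ω {s(m - Pi.single 1 1, m)}) ⁻¹' Literature.Probability.Percolation.discreteCrossing (S (-(Real.log 3) / 4) '' R.carrier) δ (S (-(Real.log 3) / 4) '' R.arc 0) (S (-(Real.log 3) / 4) '' R.arc 2)) - (μ 0).real (Literature.Probability.Percolation.discreteCrossing (S (-(Real.log 3) / 4) '' R.carrier) δ (S (-(Real.log 3) / 4) '' R.arc 0) (S (-(Real.log 3) / 4) '' R.arc 2)) else 0)| ≤ C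

/-- Absolute tightness (strengthen): no cancellation between cells at all. -/
def AbsoluteDefectSumTight : Prop :=
  ∀ (μ : ℝ → MeasureTheory.Measure (Literature.Probability.Percolation.BondConfig (Literature.Probability.LatticeModels.Site 2))) (S : ℝ → ℂ → ℂ), (∀ u, μ u = MeasureTheory.Measure.map (fun p : Set (Literature.Probability.LatticeModels.Site 2) × Set (Literature.Probability.LatticeModels.Site 2) ↦ {e | ∃ m, (m ∈ p.1 ∧ e = s(m - Pi.single 0 1, m)) ∨ ((m ∈ p.1 ↔ m ∉ p.2) ∧ e = s(m - Pi.single 1 1, m))}) ((ProbabilityTheory.setBernoulli Set.univ Literature.Probability.Percolation.half).prod (ProbabilityTheory.setBernoulli Set.univ (Set.projIcc 0 1 zero_le_one u)))) → (∀ t z, S t z = (Real.cosh t : ℂ) * z + Complex.I * (Real.sinh t : ℂ) * (starRingEnd ℂ) z) → ∀ (R : Literature.Probability.RandomPlanarGeometry.ConformalRectangle), ∃ C : ℝ, ∀ᶠ δ in nhdsWithin (0 : ℝ) (Set.Ioi 0), finsum (fun m : Literature.Probability.LatticeModels.Site 2 ↦ |(μ 0).real ((fun ω ↦ symmDiff ω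 {s(m - Pi.single 1 1, m)}) ⁻¹' Literature.Probability.Percolation.discreteCrossing (S (-(Real.log 3) / 4) '' R.carrier) δ (S (-(Real.log 3) / 4) '' R.arc 0) (S (-(Real.log 3) / 4) '' R.arc 2)) - (μ 0).real (Literature.Probability.Percolation.discreteCrossing (S (-(Real.log 3) / 4) '' R.carrier) δ (S (-(Real.log 3) / 4) '' R.arc 0) (S (-(Real.log 3) / 4) '' R.arc 2))|) ≤ C

end Summit.CriticalPhenomena.CardyFormulaZ2.Cruxes.SmirnovResponse.Strategist
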